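import Mathlib
import Literature.Analysis.FluidPDE.GaussianVortexPlanar
import Literature.Analysis.FluidPDE.GaussianVortexPlanarProofs
import Literature.Analysis.FluidPDE.BiotSavart2DSymmetry
import HarnessLib

/-!
# GaussianVortexCellProblem

Topic `Literature/Analysis/FluidPDE`. Named literature fact(s) relocated by the gate from `Summits/AnomalousDissipation/AnomalousDissipation/Theorems/MarginalStabilityChainStretchedVortexRowsStubCellSolvabilityFacts.lean`
(accept-time relocation of `[cite]`d propositions written inline in a Summits proposal; human ruling 2026-08-15).
Sources: GallayMaekawa2016, GallayWayne2006.

* `Literature.Analysis.FluidPDE.GallayMaekawa2016_lem27_classical`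
* `Literature.Analysis.FluidPDE.GallayWayne2006_prop31`
-/

namespace Literature.Analysis.FluidPDE

open scoped BigOperators Topology RealInnerProductSpace ContDiff SchwartzMap
open Filter Set Function MeasureTheory WithLp
open Literature.Analysis.FluidPDE

/-- **Gallay–Wayne 2007, Proposition 3.1.** "There exists `w_∞ ∈ 𝒮(ℝ²)` such that
`Λ w_∞ = 𝓜G`." Here `Λ w = v^G·∇w + v·∇G`, `v = K_{2D} ∗ w` (loc. cit., §1), `𝓜 = ½(x₁∂₁ − x₂∂₂)`
((1.8)) and `𝓜G = −¼(x₁² − x₂²)G` (§3, before (3.1)); explicitly `w_∞ = ω(r) sin 2θ` ((3.2)) with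
`ω = h(Ω − r²/4)` ((3.5)) and `Ω` the solution of the ODE (3.6) decaying at `0` and `∞`, built by
variation of constants ((3.9)). Stated pointwise in the tree vocabulary with `w_∞` a real-valued
Schwartz function on `ℝ²` (indices `0, 1` in Lean).
[cite: GallayWayne2006, Prop. 3.1] [topic Analysis/FluidPDE] -/
def GallayWayne2006_prop31 : Prop :=
  ∃ w : 𝓢(EuclideanSpace ℝ (Fin 2), ℝ), ∀ ξ : EuclideanSpace ℝ (Fin 2),
    ⟪gaussVortexVelocity ξ, gradient (⇑w) ξ⟫ +
        ⟪biotSavart2D (⇑w) ξ, gradient gaussVortexProfile ξ⟫ =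
      -(1 / 4) * (ξ 0 ^ 2 - ξ 1 ^ 2) * gaussVortexProfile ξ

/-- **Gallay–Maekawa 2016, Lemma 2.7 (Maekawa 2011): `ker Λ = X₀ ⊕ span{∂₁G, ∂₂G}`**, classical
corollary. In `X = L²(G⁻¹dx)` the kernel of the (skew-adjoint, maximally defined) operator
`Λ w = v^G·∇w + (K_{2D}∗w)·∇G` is the closed subspace `X₀` of radially symmetric functions plus the
plane spanned by `∂₁G, ∂₂G` (`∂ᵢG = −(xᵢ/2)G`). Specialised to classical kernel elements: a `C¹`
function `w ∈ X` whose Biot–Savart integrals converge and which satisfies `Λ w = 0` pointwise is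
a radial function plus `(β₁x₁ + β₂x₂)G`. [cite: GallayMaekawa2016, Lemma 2.7] [topic Analysis/FluidPDE] -/
def GallayMaekawa2016_lem27_classical : Prop :=
  ∀ w : EuclideanSpace ℝ (Fin 2) → ℝ, ContDiff ℝ 1 w →
    Integrable (fun ξ => (gaussVortexProfile ξ)⁻¹ * w ξ ^ 2) →
    (∀ ξ, Integrable (fun η => w η • biotSavartKernel2D (ξ - η))) →
    (∀ ξ, ⟪gaussVortexVelocity ξ, gradient w ξ⟫ +
      ⟪biotSavart2D w ξ, gradient gaussVortexProfile ξ⟫ = 0) →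
    ∃ (β₁ β₂ : ℝ) (w₀ : EuclideanSpace ℝ (Fin 2) → ℝ),
      (∀ ξ η : EuclideanSpace ℝ (Fin 2), ‖ξ‖ = ‖η‖ → w₀ ξ = w₀ η) ∧
      ∀ ξ, w ξ = w₀ ξ + (β₁ * ξ 0 + β₂ * ξ 1) * gaussVortexProfile ξ

/-! ### The vendored datum is the tree's `𝓜G` -/

end Literature.Analysis.FluidPDE
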